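import Mathlib
import Literature.NumberTheory.Automorphic.HilbertModularFormQExpansion
import Summits.Langlands.Langlands.Theorems.CapacityClassicalityHilbertIntegralOverconvergentIsCongruenceKoecherGlue

/-!
# Crux `HilbertIntegralOverconvergentIsCongruence` (stmt-Langlands-8485), line `Sketch-ideate-r1-k1`,
# section P (the `q`-expansion principle over `ℂ`): stub `stub_fourierCoeff_linear` (P2)

Section P of the line shows that the encoded `q`-expansion map of Hilbert modular forms is a
graded-algebra embedding; this file proves the registered stub `stub_fourierCoeff_linear`, the
`ℂ`-linearity of the Fourier coefficients
`a_ν(y) = ∫_{[0,1]^ι} f(x + iy) e^{-2πi S(ν(x + iy))} dx` (`HilbertModular.fourierCoeffAt`) in `f`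
for functions continuous on `ℍ`, at every height `y ≫ 0`, together with `a_ν(0) = 0`.
Proof: the vocabulary file already has `fourierCoeffAt_add` (under integrability of the two cube
integrands) and `fourierCoeffAt_const_mul`; the integrands are continuous on the compact unit cube
because `x ↦ x + iy` is continuous with values in `ℍ` (`koe_continuous_cubePoint`,
`koe_cubePoint_mem_halfSpace`), hence integrable; `c • f = fun z ↦ c * f z`; and the integrand of
the zero function vanishes identically.
-/

set_option linter.dupNamespace false

noncomputable section

namespace Summit.Langlands.Langlands.Theorems.HilbertIntegralOverconvergentIsCongruence

open MeasureTheory Complex NumberField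
open Literature.NumberTheory.Automorphic Literature.NumberTheory.Automorphic.HilbertModular

/-- The phase `z ↦ S(νz) = ∑_σ σ(ν) z_σ` is continuous on `ℂ^{Hom(F,ℝ)}`. -/
theorem fcl_continuous_pairing {F : Type} [Field F] [NumberField F] (ν : F) :
    Continuous fun z : Point F ↦ pairing ν z :=
  continuous_finsetSum _ fun σ _ ↦ continuous_const.mul (continuous_apply σ)

/-- For `f` continuous on `ℍ` and a height `y ≫ 0`, the Fourier integrand
`x ↦ f(x + iy) e^{-2πi S(ν(x + iy))}` is continuous in the cube coordinates. -/
theorem fcl_continuous_integrand {F : Type} [Field F] [NumberField F] (f : Point F → ℂ)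
    (hf : ContinuousOn f (halfSpace F)) (ν : F) {y : (F →+* ℝ) → ℝ} (hy : ∀ σ, 0 < y σ) :
    Continuous fun x : Coord F ↦
      f (cubePoint x y) * cexp (-(2 * Real.pi * I * pairing ν (cubePoint x y))) := by
  have h1 : Continuous fun x : Coord F ↦ f (cubePoint x y) :=
    hf.comp_continuous (koe_continuous_cubePoint y) fun x ↦ koe_cubePoint_mem_halfSpace x hy
  have h2 : Continuous fun x : Coord F ↦ pairing ν (cubePoint x y) :=
    (fcl_continuous_pairing ν).comp (koe_continuous_cubePoint y)
  exact h1.mul (Complex.continuous_exp.comp (continuous_const.mul h2).neg)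

/-- For `f` continuous on `ℍ` and a height `y ≫ 0`, the Fourier integrand is integrable on the unit
cube `[0,1]^ι` (continuous on a compact set). -/
theorem fcl_integrableOn_integrand {F : Type} [Field F] [NumberField F] (f : Point F → ℂ)
    (hf : ContinuousOn f (halfSpace F)) (ν : F) {y : (F →+* ℝ) → ℝ} (hy : ∀ σ, 0 < y σ) :
    IntegrableOn (fun x : Coord F ↦
      f (cubePoint x y) * cexp (-(2 * Real.pi * I * pairing ν (cubePoint x y)))) (Set.Icc 0 1) :=
  (fcl_continuous_integrand f hf ν hy).continuousOn.integrableOn_compact isCompact_Icc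

/-- **stub P2 — `stub_fourierCoeff_linear`.** The Fourier coefficients at a height `y ≫ 0` are
`ℂ`-linear on functions continuous on `ℍ` (integrability of the cube integrands), and vanish on `0`.
[folklore] -/
theorem stub_fourierCoeff_linear (F : Type) [Field F] [NumberField F] (f g : Point F → ℂ)
    (hf : ContinuousOn f (halfSpace F)) (hg : ContinuousOn g (halfSpace F)) (c : ℂ) (ν : F)
    (y : (F →+* ℝ) → ℝ) (hy : ∀ σ, 0 < y σ) :
    fourierCoeffAt (f + g) ν y = fourierCoeffAt f ν y + fourierCoeffAt g ν y ∧
      fourierCoeffAt (c • f) ν y = c * fourierCoeffAt f ν y ∧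
        fourierCoeffAt (0 : Point F → ℂ) ν y = 0 := by
  refine ⟨fourierCoeffAt_add ν y (fcl_integrableOn_integrand f hf ν hy)
    (fcl_integrableOn_integrand g hg ν hy), ?_, ?_⟩
  · have hcf : c • f = fun z ↦ c * f z := by
      funext z
      simp only [Pi.smul_apply, smul_eq_mul]
    rw [hcf]
    exact fourierCoeffAt_const_mul c f ν y
  · simp only [fourierCoeffAt, Pi.zero_apply, zero_mul, integral_zero]

end Summit.Langlands.Langlands.Theorems.HilbertIntegralOverconvergentIsCongruence
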